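import Mathlib
import Summits.Ventures.PercRepro2.SevenKernel

/-!
# The twelve-edge Kronecker certificates on seven-vertex skeletons, cover part 76: the skeletons `cov151`, `cov152`
(blind cell PercRepro2, mine-2 g34; `SevenKernel.lean` carries the definitions; the bridge `SevenTyped.HCov_seven`
turns each certificate into (HCOV) on the skeleton for every weight vector)

THE ≤ 9-EDGE COVER: the skeletons `cov47 … cov181` extend the ≤ 8-edge cover `cov01 … cov46` (`SevenCover01–23.lean`) to
a greedy cover (mining/mine-2/code/g34/cover.c, rounds 47–181 of cover200.txt) of ALL residual seven-vertex marked graphs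
with at most NINE edges — every labelled edge set of `K₇` in typer-1 g52's weighted residual `WReducedB` with `≤ 9`
edges (68 + 1,694 + 12,744; census res7.c, two codes) is, up to the root swap `a₁ ↔ a₂` and the swap of the unmarked
vertices `u ↔ w`, a subgraph of one of the 181.  Marks `(o, a₁, a₂, a₃, b) = (0, 1, 2, 3, 4)`, unmarked `u = 5`,
`w = 6`.  Census twin of every certificate: mining/mine-2/code/g34/typed7.c (exact axis-wise convolution): positive /
zero / maximum class sums in the docstrings, 0 negative on every skeleton.
-/

namespace Summit.Ventures.PercRepro2

namespace Seven

/-- **The cover skeleton `cov151`** (mask `1513084` of `K₇`, cover round 151: 12 residual sets newly covered — 12 with nine edges):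
the edges `oa₃ ob ou ow a₁a₂ a₁u a₁w a₂b a₃u a₃w bu uw`. -/
def cov151 : Fin 12 → Fin 7 × Fin 7 :=
  ![(0, 3), (0, 4), (0, 5), (0, 6), (1, 2), (1, 5), (1, 6), (2, 4), (3, 5), (3, 6), (4, 5), (5, 6)]

set_option maxRecDepth 100000 in
/-- **The certificate of `cov151`**: every typed three-copy class sum is `≥ 0`, by one `decide +kernel`
(twin: 657,787 positive class sums, 16,119,429 zeros, maximum 21,160, 0 negative). -/
theorem cert_cov151 : Cert cov151 := by
  unfold Cert
  decide +kernel

/-- **The cover skeleton `cov152`** (mask `1953049` of `K₇`, cover round 152: 20 residual sets newly covered — 20 with nine edges):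
the edges `oa₁ ob ou a₁b a₁w a₂a₃ a₂w a₃b a₃u bu bw uw`. -/
def cov152 : Fin 12 → Fin 7 × Fin 7 :=
  ![(0, 1), (0, 4), (0, 5), (1, 4), (1, 6), (2, 3), (2, 6), (3, 4), (3, 5), (4, 5), (4, 6), (5, 6)]

set_option maxRecDepth 100000 in
/-- **The certificate of `cov152`**: every typed three-copy class sum is `≥ 0`, by one `decide +kernel`
(twin: 1,669,164 positive class sums, 15,108,052 zeros, maximum 44,178, 0 negative). -/
theorem cert_cov152 : Cert cov152 := by
  unfold Cert
  decide +kernel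

end Seven

end Summit.Ventures.PercRepro2
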